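import Summits.ABC.IUTFork.Cor312ProvKIdeles
import Literature.IUT.LogVolume.Theorem110StepIIITowerNonVacuity
import Literature.IUT.LogVolume.DifferentConductorTower
import Mathlib.NumberTheory.NumberField.Discriminant.Different
import Mathlib.RingTheory.Flat.TorsionFree
import HarnessLib

/-!
# [IUTchIII] Cor. 3.12 provenance over `K = F(E_F[l])`: EVERY bad place of the `K`-level pilot datum is RAMIFIED over its prime —
# the «odd UNRAMIFIED prime» case (A) of the E3 refutation never occurs at genuine `K`-level data

PROOF-ONLY companion (0 `def`, no `Prop` fact) of the abc-iut cell (seat abc-iut-w5-d054 gen 4, S-lane number theory) to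
abc-iut-C-cert-3's `Cor312ProvK.lean` / `Cor312ProvKIdeles.lean` (p434046 / p434704: the `K`-level Dupuy–Hilado pilot datum
`Cor312Prov.pilotDataOfK D K`, `2l ∣ ord_w(q)` on its support) — written to answer, IN THE KERNEL, the C lead's question C-R19 (Q1):
«at `L := K`, `X := pilotDataOfK T.D T.K`, does case A of abc-iut-C-cert-2's E3 refutation (`Cor312NotLicenceRealSharp`, p433074 /
p433664: some bad place over an ODD prime `p ∤ disc` of the field) apply at ANY bad place?». ANSWER: **NO** — for every collection of
initial Θ-data `D` and every finite place `w` of `K` over `𝕍(F)^bad`, the residue characteristic `p` of `w` DIVIDES `disc K`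
(`residueChar_dvd_discr_of_over_VFbad`); equivalently `w` is ramified over `ℤ`, indeed `e(w|p) ≥ l ≥ 5`. REASON ([IUTchI] Ex. 3.2 (iv)
read backwards): `2l ∣ ord_w(q) = e(w|v)·ord_v(q_v)` (C-cert-3's `twoMulLDvdOrdq_pilotDataOfK`, `ordq_pilotDataOfK`) while `l` is prime to
`ord_v(q_v)` ([IUTchI] Def. 3.1 (c) as typed, `InitialThetaData.l_coprime_qParamOrd`) — so `l ∣ e(w|v)`, `e(w|p) = e(v|p)·e(w|v) ≥ l`
(tower, abc-iut's `Thm110StepIII.ramificationIdx_int_mul_ramificationIdx'`), whereas `p ∤ disc K` would force `e(w|p) = 1` (Mathlib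
`NumberField.not_dvd_discr_iff_forall_mem` + `Ideal.ramificationIdx_eq_one_of_isUnramifiedAt`, Dedekind's discriminant theorem). This is the
local picture of print: `K_w ⊇ F_v(q_v^{1/l})` is totally ramified of degree `l` over `F_v` at a bad `v` precisely BECAUSE `l ∤ ord_v(q_v)`.
CONSEQUENCE for the 12:30Z block (plan's call; nothing asserted about print): at the S_H line of record v5K (`abc_of_SH_v5K`, p434856) the
E3 case-A refutation of the hull-level antecedent is NEVER instantiable at a bad place (`not_caseA_at_pilotDataOfK`); over the
print-faithful field every bad place falls in C-cert-2's CASE B (ramified), which p433074 leaves undecided — exactly the C lead's reading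
in C-R19 (Q1), now a theorem. TAKES NO SIDE on [IUTchIII] Cor. 3.12. [cite: Mochizuki2012, IUTchI Def. 3.1 (c) p. 62; Ex. 3.2 (iv) p. 71]
[cite: NeukirchANT1999, Ch. III (2.6), (2.12)] [claim: Mochizuki2012, status: disputed] for every IUT quotation.
-/

noncomputable section

open NumberField IsDedekindDomain

namespace Summit.ABC.IUTFork.Cor312Prov

open Literature.IUT.LogVolume Literature.IUT.HodgeTheaters

variable {F K Fbar : Type} [Field F] [NumberField F] [Field K] [NumberField K] [Algebra F K] [Field Fbar]
  [Algebra F Fbar] [Algebra K Fbar] {E : WeierstrassCurve F} [E.IsElliptic] {l : ℕ} {Pb : BadPlacePredicates K}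
  (D : InitialThetaData F K Fbar E l Pb)

/-- **`l ∣ e(w|v)` at every place `w` of `K` over `𝕍(F)^bad`** (`v = w ∩ F`): `2l ∣ ord_w(q) = e(w|v)·ord_v(q_v)` ([IUTchI] Ex. 3.2 (iv),
C-cert-3's `twoMulLDvdOrdq_pilotDataOfK` / `ordq_pilotDataOfK`) and `gcd(l, ord_v(q_v)) = 1` (Def. 3.1 (c), `l_coprime_qParamOrd`).
[cite: Mochizuki2012, IUTchI Ex. 3.2 (iv) p. 71] -/
theorem l_dvd_ramificationIdx'_of_over_VFbad (w : HeightOneSpectrum (𝓞 K))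
    (hw : FinitePlace.mk (finBelow F K w) ∈ D.VFbad) :
    l ∣ Ideal.ramificationIdx' (finBelow F K w).asIdeal w.asIdeal := by
  have hS : w ∈ (pilotDataOfK D K).S := (mem_pilotDataOfK_S_iff D K w).mpr hw
  have hdvd := twoMulLDvdOrdq_pilotDataOfK D w hS
  rw [ordq_pilotDataOfK D K hS, pilotDataOfK_l] at hdvd
  have hcop : l.Coprime (qParamOrd E (finBelow F K w)) := by
    have := D.l_coprime_qParamOrd (FinitePlace.mk (finBelow F K w)) hw
    rwa [FinitePlace.maximalIdeal_mk] at this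
  have h1 : (l : ℤ) ∣ (Ideal.ramificationIdx' (finBelow F K w).asIdeal w.asIdeal : ℤ) * (qParamOrd E (finBelow F K w) : ℤ) :=
    (Dvd.intro_left 2 rfl).trans hdvd
  have h2 : l ∣ Ideal.ramificationIdx' (finBelow F K w).asIdeal w.asIdeal * qParamOrd E (finBelow F K w) := by
    exact_mod_cast h1
  exact hcop.dvd_of_dvd_mul_right h2

/-- **`e(w|p) ≥ l`** (hence `≥ 5`) at every place `w` of `K` over `𝕍(F)^bad`: `e(w|p) = e(v|p)·e(w|v)` (tower) with `l ∣ e(w|v) ≠ 0`.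
[cite: NeukirchANT1999, Ch. II (8.5)] -/
theorem l_le_ramificationIdx_int_of_over_VFbad (w : HeightOneSpectrum (𝓞 K))
    (hw : FinitePlace.mk (finBelow F K w) ∈ D.VFbad) : l ≤ w.asIdeal.ramificationIdx ℤ := by
  have hmem : w.asIdeal ∈ IsDedekindDomain.primesOverFinset (finBelow F K w).asIdeal (𝓞 K) :=
    (IsDedekindDomain.mem_primesOverFinset_iff (finBelow F K w).ne_bot _).mpr ⟨w.isPrime, liesOver_finBelow F K w⟩
  have htower := Thm110StepIII.ramificationIdx_int_mul_ramificationIdx' (finBelow F K w) hmem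
  have he : Ideal.ramificationIdx' (finBelow F K w).asIdeal w.asIdeal ≠ 0 :=
    Ideal.IsDedekindDomain.ramificationIdx'_ne_zero_of_liesOver w.asIdeal (finBelow F K w).ne_bot
  have hv : (finBelow F K w).asIdeal.ramificationIdx ℤ ≠ 0 := by
    rw [← ramIdx_eq]
    exact ramIdx_ne_zero F (finBelow F K w)
  have hl := Nat.le_of_dvd (Nat.pos_of_ne_zero he) (l_dvd_ramificationIdx'_of_over_VFbad D w hw)
  rw [← htower]
  calc l ≤ Ideal.ramificationIdx' (finBelow F K w).asIdeal w.asIdeal := hl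
    _ ≤ (finBelow F K w).asIdeal.ramificationIdx ℤ * Ideal.ramificationIdx' (finBelow F K w).asIdeal w.asIdeal :=
        Nat.le_mul_of_pos_left _ (Nat.pos_of_ne_zero hv)

/-- **Every place of `K` over `𝕍(F)^bad` is RAMIFIED over `ℤ`** (`e(w|p) ≥ l ≥ 5 > 1`). [cite: NeukirchANT1999, Ch. III (2.12)] -/
theorem not_isUnramifiedAt_int_of_over_VFbad (w : HeightOneSpectrum (𝓞 K))
    (hw : FinitePlace.mk (finBelow F K w) ∈ D.VFbad) : ¬ Algebra.IsUnramifiedAt ℤ w.asIdeal := by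
  intro hunr
  haveI := w.isPrime
  have he1 : w.asIdeal.ramificationIdx ℤ = 1 := Ideal.ramificationIdx_eq_one_of_isUnramifiedAt
  have h5 := D.five_le_l
  have hl := l_le_ramificationIdx_int_of_over_VFbad D w hw
  omega

/-- **The residue characteristic of every place of `K` over `𝕍(F)^bad` DIVIDES `disc K`** (Dedekind: `p ∤ disc K` iff every prime of
`𝓞_K` above `p` is unramified — Mathlib `NumberField.not_dvd_discr_iff_forall_mem`). So the hypothesis `hdisc : ¬ p ∣ disc` of the
E3 case-A refutation (`Cor312NotLicenceRealSharp`, p433074) FAILS at every bad place of the field `K`. [cite: NeukirchANT1999, Ch. III (2.12)] -/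
theorem residueChar_dvd_discr_of_over_VFbad (w : HeightOneSpectrum (𝓞 K))
    (hw : FinitePlace.mk (finBelow F K w) ∈ D.VFbad) : ((residueChar K w : ℕ) : ℤ) ∣ NumberField.discr K := by
  by_contra hdisc
  have hp : Prime ((residueChar K w : ℕ) : ℤ) := Nat.prime_iff_prime_int.mp (residueChar_prime K w)
  have hmem : (((residueChar K w : ℕ) : ℤ) : 𝓞 K) ∈ w.asIdeal := by
    exact_mod_cast natCast_residueChar_mem K w
  exact not_isUnramifiedAt_int_of_over_VFbad D w hw
    ((NumberField.not_dvd_discr_iff_forall_mem K (𝓞 K) hp).mp hdisc w.asIdeal w.isPrime hmem)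

/-- **C-R19 (Q1) in the kernel: at the `K`-level pilot datum of ANY initial Θ-datum, NO bad place lies over a prime `p ∤ disc K`** —
the case-A hypothesis pair «`placeOf X p x₀ ∈ X.S` and `¬ p ∣ disc K`» of `not_licence_settingPrVolSharp_of_realising` (p433664) is
contradictory for `X := pilotDataOfK D K`; the S_H antecedent of v5K sits in case B at every bad place. [claim: Mochizuki2012, status: disputed] -/
theorem not_caseA_at_pilotDataOfK (w : HeightOneSpectrum (𝓞 K)) (hS : w ∈ (pilotDataOfK D K).S)
    (hdisc : ¬ ((residueChar K w : ℕ) : ℤ) ∣ NumberField.discr K) : False :=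
  hdisc (residueChar_dvd_discr_of_over_VFbad D w ((mem_pilotDataOfK_S_iff D K w).mp hS))

/-- The same with the prime presented as any `p ∈ 𝔭_w` (the shape `natCast_mem_placeOf` of the setting files): `p ∣ disc K`.
[cite: NeukirchANT1999, Ch. III (2.12)] -/
theorem natCast_dvd_discr_of_mem_pilotDataOfK_S (w : HeightOneSpectrum (𝓞 K)) (hS : w ∈ (pilotDataOfK D K).S)
    (p : ℕ) [Fact p.Prime] (hp : ((p : ℕ) : 𝓞 K) ∈ w.asIdeal) : (p : ℤ) ∣ NumberField.discr K := by
  have h := residueChar_dvd_discr_of_over_VFbad D w ((mem_pilotDataOfK_S_iff D K w).mp hS)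
  rwa [Thm311.Real.residueChar_eq_of_natCast_mem p hp] at h


/-! ## APPENDIX (abc-iut-C-cert-2, the C-R19 (Q1) addressee; append-only): the phenomenon is forced by the REALISING condition itself —
general extensions `L ⊇ F` under `2l ∣ ord_w(q)` —, the answer in the literal binder shape of p433074, and «odd, `≠ l`» at the bad places

Independent concordance with abc-iut-w5-d054's theorems above (reached the same route 11 minutes later; nothing above is restated — the
`K`-level statements below are one-line compositions of the ones above or of the general-`L` ones). What is ADDED: (1) a Dedekind lemma
for an arbitrary subfield, `e(w|v) ≠ 1 ⇒ p ∣ disc(L)`, via the multiplicativity `e(w|v) ∣ e(w|p)` of Mathlib's `Ideal.ramificationIdx` in the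
tower `ℤ ⊆ 𝓞_F ⊆ 𝓞_L` (`Ideal.ramificationIdx_above_dvd`; `𝓞_L` is torsion-free, hence flat, over the Dedekind domain `𝓞_F`); (2) for ANY
extension `L ⊇ F`, the realising-ideles condition `TwoMulLDvdOrdq (pilotDataOfK D L)` ALONE forces `l ∣ e(w|v)` and `p ∣ disc(L)` at every
bad place — so case A of `Cor312NotLicenceRealSharp` is void at EVERY base-changed genuine datum that admits realising ideles, not only over
`K`; (3) the `K`-level answer in the literal binder shape `(pp : Nat.Primes) (x₀ : Fibre (.inr pp))`, `placeOf X pp.1 x₀ ∈ X.S` of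
`not_licence_settingPrVolSharp_of_realising`; (4) the bad places of the `K`-level datum have residue characteristic `≠ 2` and `≠ l`
([IUTchI] Def. 3.1 (b),(c)) — of the case-B description «over `2` or ramified» only «ramified, odd, `≠ l`, `e(w|p) ≥ l`» occurs over `K`.
No side taken; typed ≠ proved; instantiated ≠ endorsed. -/

section AppendixDedekind

variable (L : Type) [Field L] [NumberField L] [Algebra F L]

open Thm311 Thm311.Real

omit [NumberField F] in
/-- `e(w|v) ≠ 0` for the place `v = w ∩ 𝓞_F` under a prime `w` of `𝓞_L`. [cite: NeukirchANT1999, Ch. I (8.2)] -/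
theorem ramificationIdx'_finBelow_ne_zero (w : HeightOneSpectrum (𝓞 L)) :
    (finBelow F L w).asIdeal.ramificationIdx' w.asIdeal ≠ 0 :=
  Ideal.IsDedekindDomain.ramificationIdx'_ne_zero_of_liesOver w.asIdeal (finBelow F L w).ne_bot

/-- **`e(w|v) ≠ 1 ⇒ p ∣ disc(L)`** for an arbitrary subfield `F ⊆ L`. If a prime `w` of `𝓞_L` containing the rational prime `p` has
ramification index `≠ 1` over `v = w ∩ 𝓞_F`, then `p` divides the absolute discriminant of `L`: `e(w|v) ∣ e(w|p)` (Mathlib's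
`Ideal.ramificationIdx` is multiplicative in `ℤ ⊆ 𝓞_F ⊆ 𝓞_L`, `Ideal.ramificationIdx_above_dvd`) and Dedekind's theorem
(`NumberField.not_dvd_discr_iff_forall_mem`). [cite: NeukirchANT1999, Ch. III Thm. (2.12)] -/
theorem natCast_dvd_discr_of_ramificationIdx'_finBelow_ne_one (p : ℕ) [hp : Fact p.Prime] (w : HeightOneSpectrum (𝓞 L))
    (hpw : ((p : ℕ) : 𝓞 L) ∈ w.asIdeal) (he : (finBelow F L w).asIdeal.ramificationIdx' w.asIdeal ≠ 1) :
    ((p : ℕ) : ℤ) ∣ NumberField.discr L := by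
  by_contra hdisc
  have hpZ : Prime (p : ℤ) := Nat.prime_iff_prime_int.mp hp.out
  haveI : Algebra.IsUnramifiedAt ℤ w.asIdeal :=
    (NumberField.not_dvd_discr_iff_forall_mem L (𝓞 L) hpZ).mp hdisc w.asIdeal inferInstance (by exact_mod_cast hpw)
  -- `e(w|ℤ) = 1`
  have h1 : w.asIdeal.ramificationIdx ℤ = 1 := Ideal.ramificationIdx_eq_one_of_isUnramifiedAt
  -- `e(w|𝓞_F) ∣ e(w|ℤ)` (tower `ℤ ⊆ 𝓞_F ⊆ 𝓞_L`)
  have h2 : w.asIdeal.ramificationIdx (𝓞 F) ∣ w.asIdeal.ramificationIdx ℤ :=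
    Ideal.ramificationIdx_above_dvd (R := ℤ) (finBelow F L w).asIdeal w.asIdeal
  rw [h1, Nat.dvd_one] at h2
  -- the tree's (old-style) index `ramificationIdx' v w` IS `e(w|𝓞_F)`
  have h3 : (finBelow F L w).asIdeal.ramificationIdx' w.asIdeal = w.asIdeal.ramificationIdx (𝓞 F) :=
    Ideal.ramificationIdx'_eq_ramificationIdx (finBelow F L w).asIdeal w.asIdeal (finBelow F L w).ne_bot
  exact he (h3.trans h2)

end AppendixDedekind

section AppendixGeneralExtension

variable (L : Type) [Field L] [NumberField L] [Algebra F L]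

open Thm311 Thm311.Real

/-- **`l ∣ e(w|v)` at every bad place of `pilotDataOfK D L`, for ANY extension `L ⊇ F`, as soon as `2l ∣ ord_w(q)` there**
(`TwoMulLDvdOrdq`, the condition under which realising ideles exist): `ord_w(q) = e(w|v)·ord_v(q_v)` (`ordq_pilotDataOfK`) with
`l ∤ ord_v(q_v)` ([IUTchI] Def. 3.1 (c), `l_coprime_qParamOrd`). [cite: Mochizuki2012, IUTchI Def. 3.1 (c) p. 61, Ex. 3.2 (iv) p. 71] -/
theorem l_dvd_ramificationIdx'_of_twoMulLDvdOrdq (h : TwoMulLDvdOrdq (pilotDataOfK D L))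
    {w : HeightOneSpectrum (𝓞 L)} (hw : w ∈ (pilotDataOfK D L).S) :
    l ∣ (finBelow F L w).asIdeal.ramificationIdx' w.asIdeal := by
  have hv : FinitePlace.mk (finBelow F L w) ∈ D.VFbad := (mem_pilotDataOfK_S_iff D L w).mp hw
  have hdvd : (l : ℤ) ∣ ((finBelow F L w).asIdeal.ramificationIdx' w.asIdeal : ℤ) * (qParamOrd E (finBelow F L w) : ℤ) := by
    have h2l := h w hw
    rw [ordq_pilotDataOfK D L hw, pilotDataOfK_l] at h2l
    exact (Dvd.intro_left _ rfl).trans h2l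
  have hcop : l.Coprime (qParamOrd E (finBelow F L w)) := by
    have hc := D.l_coprime_qParamOrd (FinitePlace.mk (finBelow F L w)) hv
    rwa [FinitePlace.maximalIdeal_mk] at hc
  have hcopZ : IsCoprime (l : ℤ) (qParamOrd E (finBelow F L w) : ℤ) := Nat.isCoprime_iff_coprime.mpr hcop
  exact_mod_cast hcopZ.dvd_of_dvd_mul_right hdvd

/-- **`l ≤ e(w|v)`** (so `5 ≤ e(w|v)`) at every bad place of `pilotDataOfK D L` with `2l ∣ ord_w(q)`, any `L ⊇ F`.
[cite: Mochizuki2012, IUTchI Def. 3.1 (c) p. 61, Ex. 3.2 (iv) p. 71] -/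
theorem l_le_ramificationIdx'_of_twoMulLDvdOrdq (h : TwoMulLDvdOrdq (pilotDataOfK D L))
    {w : HeightOneSpectrum (𝓞 L)} (hw : w ∈ (pilotDataOfK D L).S) :
    l ≤ (finBelow F L w).asIdeal.ramificationIdx' w.asIdeal :=
  Nat.le_of_dvd (Nat.pos_of_ne_zero (ramificationIdx'_finBelow_ne_zero L w)) (l_dvd_ramificationIdx'_of_twoMulLDvdOrdq D L h hw)

/-- **`e(w|v) ≠ 1`** at every bad place of `pilotDataOfK D L` with `2l ∣ ord_w(q)`, any `L ⊇ F` (`l ≥ 5`).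
[cite: Mochizuki2012, IUTchI Def. 3.1 (c) p. 61, Ex. 3.2 (iv) p. 71] -/
theorem ramificationIdx'_ne_one_of_twoMulLDvdOrdq (h : TwoMulLDvdOrdq (pilotDataOfK D L))
    {w : HeightOneSpectrum (𝓞 L)} (hw : w ∈ (pilotDataOfK D L).S) :
    (finBelow F L w).asIdeal.ramificationIdx' w.asIdeal ≠ 1 := by
  have h5 := D.five_le_l
  have hle := l_le_ramificationIdx'_of_twoMulLDvdOrdq D L h hw
  omega

/-- **For ANY `L ⊇ F`: every bad place of `pilotDataOfK D L` with `2l ∣ ord_w(q)` lies over a rational prime dividing `disc(L)`** —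
case A of `Cor312NotLicenceRealSharp` (`p ∤ disc` under a bad place) is void at every base-changed genuine datum admitting realising
ideles. [cite: Mochizuki2012, IUTchI Def. 3.1 (c) p. 61, Ex. 3.2 (iv) p. 71] [cite: NeukirchANT1999, Ch. III Thm. (2.12)] -/
theorem natCast_dvd_discr_of_mem_S_of_twoMulLDvdOrdq (h : TwoMulLDvdOrdq (pilotDataOfK D L)) (p : ℕ) [Fact p.Prime]
    {w : HeightOneSpectrum (𝓞 L)} (hpw : ((p : ℕ) : 𝓞 L) ∈ w.asIdeal) (hw : w ∈ (pilotDataOfK D L).S) :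
    ((p : ℕ) : ℤ) ∣ NumberField.discr L :=
  natCast_dvd_discr_of_ramificationIdx'_finBelow_ne_one L p w hpw (ramificationIdx'_ne_one_of_twoMulLDvdOrdq D L h hw)

/-- The same in the fibre language of the real settings (`x₀` in the fibre of `𝕍(L) → 𝕍_ℚ` over `pp`, `placeOf X pp.1 x₀`), i.e. in the
literal binder shape of `Thm311.Real.not_licence_settingPrVolSharp_of_realising`: its hypothesis pair (`hdisc`, `hx₀`) is contradictory
at `X := pilotDataOfK D L` whenever `TwoMulLDvdOrdq X`. [cite: Mochizuki2012, IUTchI Def. 3.1 (c) p. 61, Ex. 3.2 (iv) p. 71] -/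
theorem caseA_hypotheses_unsat_of_twoMulLDvdOrdq (h : TwoMulLDvdOrdq (pilotDataOfK D L)) (pp : Nat.Primes)
    (x₀ : (thetaIndex (pilotDataOfK D L)).Fibre (.inr pp)) :
    ¬ (¬ ((pp : ℕ) : ℤ) ∣ NumberField.discr L ∧
        (haveI : Fact (pp : ℕ).Prime := ⟨pp.2⟩; placeOf (pilotDataOfK D L) pp.1 x₀ ∈ (pilotDataOfK D L).S)) := by
  haveI : Fact (pp : ℕ).Prime := ⟨pp.2⟩
  exact fun hx => hx.1 (natCast_dvd_discr_of_mem_S_of_twoMulLDvdOrdq D L h pp.1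
    (natCast_mem_placeOf (pilotDataOfK D L) pp.1 x₀) hx.2)

end AppendixGeneralExtension

section AppendixOverK

open Thm311 Thm311.Real

/-- **C-R19 (Q1) in the literal binder shape of p433074 / p433664** (`pp : Nat.Primes`, `x₀` in the fibre over `pp`,
`placeOf X pp.1 x₀ ∈ X.S`, `¬ pp ∣ disc`): contradictory at `X := pilotDataOfK D K` — one line from abc-iut-w5-d054's
`natCast_dvd_discr_of_mem_pilotDataOfK_S` above. [cite: Mochizuki2012, IUTchI Def. 3.1 (c),(e) pp. 61–62, Ex. 3.2 (iv) p. 71] -/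
theorem caseA_hypotheses_unsat_pilotDataOfK (pp : Nat.Primes) (x₀ : (thetaIndex (pilotDataOfK D K)).Fibre (.inr pp)) :
    ¬ (¬ ((pp : ℕ) : ℤ) ∣ NumberField.discr K ∧
        (haveI : Fact (pp : ℕ).Prime := ⟨pp.2⟩; placeOf (pilotDataOfK D K) pp.1 x₀ ∈ (pilotDataOfK D K).S)) := by
  haveI : Fact (pp : ℕ).Prime := ⟨pp.2⟩
  exact fun hx => hx.1 (natCast_dvd_discr_of_mem_pilotDataOfK_S D _ hx.2 pp.1 (natCast_mem_placeOf (pilotDataOfK D K) pp.1 x₀))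

/-- **The bad places of the `K`-level pilot datum have residue characteristic `≠ 2` and `≠ l`** ([IUTchI] Def. 3.1 (b) «odd residue
characteristic», (c) «`l` prime to the elements of `𝕍^bad_mod`», via `InitialThetaData.two_not_mem_and_l_not_mem_of_mem_VFbad`), in the
fibre language: of the case-B description «over `2` or over a ramified prime» only the ramified branch occurs over `K`.
[cite: Mochizuki2012, IUTchI Def. 3.1 (b),(c) p. 61] -/
theorem ne_two_and_ne_l_of_placeOf_mem_S_pilotDataOfK (pp : Nat.Primes) (x : (thetaIndex (pilotDataOfK D K)).Fibre (.inr pp))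
    (hx : haveI : Fact (pp : ℕ).Prime := ⟨pp.2⟩; placeOf (pilotDataOfK D K) pp.1 x ∈ (pilotDataOfK D K).S) :
    (pp : ℕ) ≠ 2 ∧ (pp : ℕ) ≠ l := by
  haveI : Fact (pp : ℕ).Prime := ⟨pp.2⟩
  set w := placeOf (pilotDataOfK D K) pp.1 x with hwdef
  have hv : FinitePlace.mk (finBelow F K w) ∈ D.VFbad := (mem_pilotDataOfK_S_iff D K w).mp hx
  haveI : w.asIdeal.LiesOver (FinitePlace.mk (finBelow F K w)).maximalIdeal.asIdeal := by
    rw [FinitePlace.maximalIdeal_mk]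
    exact liesOver_finBelow F K w
  have h := D.two_not_mem_and_l_not_mem_of_mem_VFbad hv (vK := w)
  have hp : ((pp : ℕ) : 𝓞 K) ∈ w.asIdeal := natCast_mem_placeOf (pilotDataOfK D K) pp.1 x
  refine ⟨fun h2 => h.1 ?_, fun hl => h.2 ?_⟩
  · rw [h2] at hp
    exact_mod_cast hp
  · rw [hl] at hp
    exact hp

/-- **The residue characteristic of a place of `K` over `𝕍(F)^bad` is odd and `≠ l`** (place form of the preceding).
[cite: Mochizuki2012, IUTchI Def. 3.1 (b),(c) p. 61] -/
theorem residueChar_ne_two_and_ne_l_of_over_VFbad (w : HeightOneSpectrum (𝓞 K))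
    (hw : FinitePlace.mk (finBelow F K w) ∈ D.VFbad) : (residueChar K w : ℕ) ≠ 2 ∧ (residueChar K w : ℕ) ≠ l := by
  haveI : w.asIdeal.LiesOver (FinitePlace.mk (finBelow F K w)).maximalIdeal.asIdeal := by
    rw [FinitePlace.maximalIdeal_mk]
    exact liesOver_finBelow F K w
  have h := D.two_not_mem_and_l_not_mem_of_mem_VFbad hw (vK := w)
  have hp : (((residueChar K w : ℕ) : ℕ) : 𝓞 K) ∈ w.asIdeal := natCast_residueChar_mem K w
  refine ⟨fun h2 => h.1 ?_, fun hl => h.2 ?_⟩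
  · rw [h2] at hp
    exact_mod_cast hp
  · rw [hl] at hp
    exact hp

end AppendixOverK

end Summit.ABC.IUTFork.Cor312Prov

end
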